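/-
Copyright (c) 2026 the pub-hodgecm-mathlib formalisation cell (harness21).  Prover seat hodgecm-mathlib-LH4-p17 (g3) (Track A «FOUR-FRAME» free hand routed to L1 by the
CHAIR VALVE; LEAD F0P6-plan (g15) BATCH #225 «(D-arch-loc)»; block-D desk K2Liu-p12; K1-a♮ line lead K2E5-p16 (g8); second reader F0P2-p11 (g3) (block-D package);
consumer ★ p863921 (this seat) `K2LiuIncoherentRankOneArchSplitOfFaces.hsplit_faces_of_archLetters`), Track B «K2-LIT», #184♮ = hLiu418 = `stmt-HodgeConjecture-24832`.
THEOREMS ONLY (no `def`, no instance, no notation, no named-fact hypothesis, no `sorry`, default heartbeats).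
-/
import Summits.HodgeConjecture.HodgeConjecture.Theorems.K2LiuIncoherentRankOneArchSplitOfFaces   -- ★ p863921 (this seat): `hsplit_faces_of_archLetters` + the frame vocabulary
import Mathlib.LinearAlgebra.SymplecticGroup                                                     -- `Matrix.J`
import HarnessLib

/-!
# Crux `HLiu418`, #42S organ S5, BLOCK D row D-1 — (D-arch-loc) THE PER-PLACE ARCH LETTERS `Aloc Acw hAcw hAw` OF ★ p863921 FROM LOCAL LETTERS AT THE `w`-COMPONENT
# (the adapter: a local continuation on `U(J)(ℂ) = {g ∣ gᴴJg = J}` composed with the `w`-component map of the adelic point IS the adelic-point-indexed letter)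

Cell `hodgecm-mathlib`, crux item hLiu418 = `stmt-HodgeConjecture-24832`, route `HCCMUnconditional`; squad K2 ∕ K2Liu (L1, LEAD F0P6-plan (g15)).  Lane
`--supports stmt-HodgeConjecture-24832 --as helper` (count-neutral).  CLOSES NO SOCKET.

THE SLOT (★ p863921 `K2LiuIncoherentRankOneArchSplitOfFaces.hsplit_faces_of_archLetters`, its per-place binders; F0P2-p11 (g3) CENSUS #211 «residual of the LH4-p17 lineage»):
  `Aloc Acw : Skew → φ → InfinitePlace L → ℂ → H(𝔸) → ℂ`,
  `hAcw : ∀ X, ↑X ≠ 0 → det ↑X = 0 → ∀ h, ∀ i ∈ I X h, ∀ w ∈ Tinf, DifferentiableOn ℂ (fun s => Acw X i w s h) {0 < re}`,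
  `hAw  : ∀ X, ↑X ≠ 0 → det ↑X = 0 → ∀ h, ∀ i ∈ I X h, ∀ w ∈ Tinf, ∀ s, 1/2 < s.re → Aloc X i w s h = Acw X i w s h`
— the raw LOCAL archimedean block of the face `i` at the complex place `w`, as a function of the ADELIC point `h`, and ONE continuation of it.  The archimedean producers are
LOCAL: ★ p863717 `K2LiuArchTwistedKTypeBlockContinuation.exists_archLetters_scalarType{_neg}` and the explicit ★ p864004 `K2LiuArchTwistedScalarLettersExplicit.
exists_archLetters_scalarType_explicit{_neg}` (R90-C131-p02) give, per index datum, `Ac₀ : ℂ → M₄(ℂ) → ℂ` with `∀ g, gᴴJg = J → DifferentiableOn ℂ (fun s => Ac₀ s g) {0 < re}`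
and `∀ s, 1/2 < s.re → ∀ g, gᴴJg = J → (raw twisted block at g) = Ac₀ s g` — functions of the LOCAL point `g ∈ U(J)(ℂ) = {g ∣ gᴴ · J · g = J}` (`J = Matrix.J (Fin 2) ℂ`, the tube form).
THE ADAPTER.  The adelic point enters the local block only through its `w`-COMPONENT in the tube frame, `comp X h w ∈ U(J)(ℂ)` — of record `comp X h w := Fr ((gc X · h)_∞) w` for the frame
map `Fr` of ★ `K2LiuHolTubeRigidityOfFrame` §2 (`frame_mem : (Fr a w)ᴴ · J · Fr a w = J` from the letters `hFr hTU`; `(·)_∞ = archPart`, `gc X` = ★ p863805's corner translate).  So with the component map and its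
unitarity BY VALUE (`comp`, `hcomp`) and the local letters BY VALUE per `(X, i, w)` (`Araw Ac₀ hAc₀ hA₀`, in ★ p863717's shape, guarded like the slot), the adelic-point-indexed letters are
the COMPOSITIONS `Aloc X i w s h := Araw X i w s (comp X h w)`, `Acw X i w s h := Ac₀ X i w s (comp X h w)` — EXPLICIT ((F-V) transparent: any further local property of `Ac₀`, e.g.
★ p864004's vanishing clauses at `s = ½` for row D-3's `hAzero`, transports by `rfl`).
* §1 generic (index ∕ point ∕ face ∕ place ∕ local-point types, local group `U w : P → Prop`): **`hAcw_of_localLetters`**, **`hAw_of_localLetters`** (the two compositions), and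
  **`exists_placeLetters_of_localExists`** (`choose`, for producers holding only the per-place `∃ Ac₀, …` of ★ p863717).
* §2 AT THE K2_Liu FRAME (`P := M₄(ℂ)`, `U w g := gᴴ * Matrix.J (Fin 2) ℂ * g = Matrix.J (Fin 2) ℂ`): **`hAcw_of_archLocalLetters`**, **`hAw_of_archLocalLetters`** — ★ p863921's
  `hAcw`∕`hAw` binder types VERBATIM at `Acw := fun X i w s h => Ac₀ X i w s (comp X h w)`, `Aloc := fun X i w s h => Araw X i w s (comp X h w)`; **`exists_archPlaceLetters_of_localExists`**
  (∃-form); and the JUNCTION **`hsplit_faces_of_archLocalLetters`** = ★ p863921 `hsplit_faces_of_archLetters` with `Aloc Acw hAcw hAw` DISCHARGED: from ★ p863404's `I A Ac hAc hA`,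
  `comp hcomp`, `Araw Ac₀ hAc₀ hA₀` and the place-tensor letter `cA hAinf` (now about `Araw X i w s (comp X h w)`) ⟹ ★ p863709's `hsplit` at `Aw := fun X h i w => Ac₀ X i w (1/2) (comp X h w)`.
* §3 THE COMPONENT MAP OF RECORD (rank `2`, `e : Fin N × Fin M ≃ Fin 2`): `comp X h w := Fr (archPart (gc X * h)) ⟨w, _⟩` over the tube frame `Fr` and the corner translate `gc` (every infinite place of the CM field `L` is
  complex, Mathlib `IsTotallyComplex.isComplex`), `hcomp` = ★ `frame_mem`'s conclusion BY VALUE (`hFrU`): **`hcomp_of_frame`**, **`hAcw_of_frame`**, **`hAw_of_frame`**.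
HONEST LABEL.  Count-neutral helper (composition + `choose`); the local letters, the component map's unitarity and the place-tensor letter enter BY VALUE (payers: ★ p863717 ∕
★ p864004 per place at the index data of the face; ★ `K2LiuHolTubeRigidityOfFrame.frame_mem`; (D-arch-Fub)); `HC_CM` is proved only modulo the 7 printed citations
(2 remaining named inputs: hLiu418 = `stmt-HodgeConjecture-24832`, h413 = `stmt-HodgeConjecture-24833`) until rung 0 closes.

## References
* [Shimura1982] G. Shimura, *Confluent hypergeometric functions on tube domains*, Math. Ann. 260 (1982): §4 Thm. 4.2 (continuation of the local archimedean Whittaker factor).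
* [Shimura1997] G. Shimura, *Euler Products and Eisenstein Series*, CBMS 93 (1997): §5 (tube realisation `U(J)`), §18.4–18.5 (archimedean factors place by place).
* [KudlaRallis1994] S. Kudla, S. Rallis, *A regularized Siegel–Weil formula: the first term identity*, Ann. of Math. 140 (1994): §2 (2.10)–(2.12).
* [BorelJacquet1979] A. Borel, H. Jacquet, *Automorphic forms and automorphic representations*, PSPM 33.1 (1979): §4.1 (archimedean components of adelic points).
-/

set_option autoImplicit false
set_option linter.dupNamespace false -- the mandated namespace repeats `HodgeConjecture.HodgeConjecture`

noncomputable section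

open scoped Matrix
open NumberField NumberField.InfinitePlace IsDedekindDomain
open Literature.NumberTheory.Automorphic Literature.NumberTheory.Automorphic.UnitaryGroup Literature.NumberTheory.GaloisRepresentations
open Literature.NumberTheory.GelbartRogawski1991 Literature.NumberTheory.GelbartRogawski1991.GRConstruction

namespace Summit.HodgeConjecture.HodgeConjecture.Cruxes.HLiu418.K2LiuIncoherentRankOneArchPlaceLettersOfScalarType

open K2LiuSiegelUnipotentFourierDefs
open K2LiuIncoherentRankOneArchSplitOfFaces (hsplit_faces_of_archLetters)

/-! ## §1 Generic: local letters at the `w`-component are adelic-point-indexed letters -/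

/-- **HOLOMORPHY OF THE COMPOSITION.**  Index type `I` (rank one cut out by `p X → q X →`), point type `H`, faces `i ∈ Iset X h`, places `w ∈ Tinf`, local point type `P` with the
local group `U w : P → Prop`; a component map `comp : I → H → α → P` landing in the local groups (`hcomp`); local continuations `Ac₀ X i w : ℂ → P → ℂ` holomorphic on `{0 < re}` in `s` at
every local point of `U w` (`hAc₀`, ★ p863717's first clause, guarded like the slot) ⟹ `s ↦ Ac₀ X i w s (comp X h w)` is holomorphic on `{0 < re}` — ★ p863921's `hAcw` for the composition.
[cite: Shimura1982, §4 Thm. 4.2] [cite: BorelJacquet1979, §4.1] -/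
theorem hAcw_of_localLetters {I H φ α P : Type*} (p q : I → Prop) (Iset : I → H → Finset φ) (Tinf : Finset α)
    (U : α → P → Prop) (comp : I → H → α → P) (hcomp : ∀ (X : I) (h : H), ∀ w ∈ Tinf, U w (comp X h w))
    (Ac₀ : I → φ → α → ℂ → P → ℂ)
    (hAc₀ : ∀ X, p X → q X → ∀ (h : H), ∀ i ∈ Iset X h, ∀ w ∈ Tinf, ∀ g, U w g → DifferentiableOn ℂ (fun s => Ac₀ X i w s g) {s : ℂ | 0 < s.re}) :
    ∀ X, p X → q X → ∀ (h : H), ∀ i ∈ Iset X h, ∀ w ∈ Tinf, DifferentiableOn ℂ (fun s => Ac₀ X i w s (comp X h w)) {s : ℂ | 0 < s.re} :=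
  fun X hp hq h i hi w hw => hAc₀ X hp hq h i hi w hw (comp X h w) (hcomp X h w hw)

/-- **AGREEMENT OF THE COMPOSITIONS ON `{½ < re}`.**  Raw local blocks `Araw X i w : ℂ → P → ℂ` agreeing with `Ac₀ X i w` on `{½ < re}` at every local point of `U w` (`hA₀`, ★ p863717's
second clause, guarded like the slot) ⟹ `Araw X i w s (comp X h w) = Ac₀ X i w s (comp X h w)` for `½ < re s` — ★ p863921's `hAw` for the compositions.
[cite: Shimura1982, §4 Thm. 4.2] [cite: Shimura1997, §18.4] -/
theorem hAw_of_localLetters {I H φ α P : Type*} (p q : I → Prop) (Iset : I → H → Finset φ) (Tinf : Finset α)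
    (U : α → P → Prop) (comp : I → H → α → P) (hcomp : ∀ (X : I) (h : H), ∀ w ∈ Tinf, U w (comp X h w))
    (Araw Ac₀ : I → φ → α → ℂ → P → ℂ)
    (hA₀ : ∀ X, p X → q X → ∀ (h : H), ∀ i ∈ Iset X h, ∀ w ∈ Tinf, ∀ s : ℂ, 1 / 2 < s.re → ∀ g, U w g → Araw X i w s g = Ac₀ X i w s g) :
    ∀ X, p X → q X → ∀ (h : H), ∀ i ∈ Iset X h, ∀ w ∈ Tinf, ∀ s : ℂ, 1 / 2 < s.re → Araw X i w s (comp X h w) = Ac₀ X i w s (comp X h w) :=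
  fun X hp hq h i hi w hw s hs => hA₀ X hp hq h i hi w hw s hs (comp X h w) (hcomp X h w hw)

/-- **∃-FORM (for producers holding only the per-place existence).**  If per `(X, h, i, w)` SOME local continuation exists (★ p863717's conclusion shape BY VALUE: `∃ Ac₀, (∀ g, U w g →
holomorphic) ∧ (∀ s, ½ < re s → ∀ g, U w g → Araw = Ac₀)`), then adelic-point-indexed letters `Acw` with ★ p863921's `hAcw`∕`hAw` exist for `Aloc X i w s h := Araw X i w s (comp X h w)`
(choice over `(X, h, i, w)`). [cite: Shimura1982, §4 Thm. 4.2] [cite: BorelJacquet1979, §4.1] -/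
theorem exists_placeLetters_of_localExists {I H φ α P : Type*} (p q : I → Prop) (Iset : I → H → Finset φ) (Tinf : Finset α)
    (U : α → P → Prop) (comp : I → H → α → P) (hcomp : ∀ (X : I) (h : H), ∀ w ∈ Tinf, U w (comp X h w))
    (Araw : I → φ → α → ℂ → P → ℂ)
    (hloc : ∀ X, p X → q X → ∀ (h : H), ∀ i ∈ Iset X h, ∀ w ∈ Tinf, ∃ Ac₀ : ℂ → P → ℂ,
      (∀ g, U w g → DifferentiableOn ℂ (fun s => Ac₀ s g) {s : ℂ | 0 < s.re}) ∧
      (∀ s : ℂ, 1 / 2 < s.re → ∀ g, U w g → Araw X i w s g = Ac₀ s g)) :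
    ∃ Acw : I → φ → α → ℂ → H → ℂ,
      (∀ X, p X → q X → ∀ (h : H), ∀ i ∈ Iset X h, ∀ w ∈ Tinf, DifferentiableOn ℂ (fun s => Acw X i w s h) {s : ℂ | 0 < s.re}) ∧
      (∀ X, p X → q X → ∀ (h : H), ∀ i ∈ Iset X h, ∀ w ∈ Tinf, ∀ s : ℂ, 1 / 2 < s.re → Araw X i w s (comp X h w) = Acw X i w s h) := by
  choose! Ac₀ hAc₀ hA₀ using hloc
  exact ⟨fun X i w s h => Ac₀ X h i w s (comp X h w),
    fun X hp hq h i hi w hw => hAc₀ X hp hq h i hi w hw (comp X h w) (hcomp X h w hw),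
    fun X hp hq h i hi w hw s hs => hA₀ X hp hq h i hi w hw s hs (comp X h w) (hcomp X h w hw)⟩

/-! ## §2 At the K2_Liu frame: ★ p863921's per-place binders from local letters on `U(J)(ℂ)` -/

section Frame

variable (L : Type) [Field L] [NumberField L] [IsCMField L]

variable {N M n : ℕ} (e : Fin N × Fin M ≃ Fin n)
  (dV : Fin N → L) (hdV : ∀ i, IsCMField.complexConj L (dV i) = dV i)
  (dW : Fin M → L) (hdW : ∀ i, IsCMField.complexConj L (dW i) = dW i)

/-- **★ p863921's `hAcw` FROM LOCAL LETTERS.**  Component map `comp : Skew → H(𝔸) → InfinitePlace L → M₄(ℂ)` into the tube group (`hcomp : (comp X h w)ᴴ · J · comp X h w = J` on `Tinf`; of record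
`Fr (archPart h) w`, ★ `frame_mem`) and local continuations `Ac₀ X i w : ℂ → M₄(ℂ) → ℂ` holomorphic on `{0 < re}` at every `g ∈ U(J)(ℂ)` (★ p863717 ∕ ★ p864004's first clause, guarded
like the slot) ⟹ ★ p863921's `hAcw` binder VERBATIM at `Acw := fun X i w s h => Ac₀ X i w s (comp X h w)`. [cite: Shimura1982, §4 Thm. 4.2] [cite: Shimura1997, §5] -/
theorem hAcw_of_archLocalLetters {φ : Type*}
    (I : skewMatrices ((IsCMField.complexConj L : L ≃ₐ[Fp L] L) : L →+* L) ((gramR L e dV hdV dW hdW).map (algebraMap (Fp L) L)) → HA L e dV hdV dW hdW → Finset φ)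
    (Tinf : Finset (InfinitePlace L))
    (comp : skewMatrices ((IsCMField.complexConj L : L ≃ₐ[Fp L] L) : L →+* L) ((gramR L e dV hdV dW hdW).map (algebraMap (Fp L) L)) → HA L e dV hdV dW hdW → InfinitePlace L →
      Matrix (Fin 2 ⊕ Fin 2) (Fin 2 ⊕ Fin 2) ℂ)
    (hcomp : ∀ (X : skewMatrices ((IsCMField.complexConj L : L ≃ₐ[Fp L] L) : L →+* L) ((gramR L e dV hdV dW hdW).map (algebraMap (Fp L) L))) (h : HA L e dV hdV dW hdW), ∀ w ∈ Tinf,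
      (comp X h w)ᴴ * Matrix.J (Fin 2) ℂ * comp X h w = Matrix.J (Fin 2) ℂ)
    (Ac₀ : skewMatrices ((IsCMField.complexConj L : L ≃ₐ[Fp L] L) : L →+* L) ((gramR L e dV hdV dW hdW).map (algebraMap (Fp L) L)) → φ → InfinitePlace L → ℂ →
      Matrix (Fin 2 ⊕ Fin 2) (Fin 2 ⊕ Fin 2) ℂ → ℂ)
    (hAc₀ : ∀ X : skewMatrices ((IsCMField.complexConj L : L ≃ₐ[Fp L] L) : L →+* L) ((gramR L e dV hdV dW hdW).map (algebraMap (Fp L) L)),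
      (X : Matrix (Fin n) (Fin n) L) ≠ 0 → (X : Matrix (Fin n) (Fin n) L).det = 0 → ∀ (h : HA L e dV hdV dW hdW), ∀ i ∈ I X h, ∀ w ∈ Tinf,
        ∀ g : Matrix (Fin 2 ⊕ Fin 2) (Fin 2 ⊕ Fin 2) ℂ, gᴴ * Matrix.J (Fin 2) ℂ * g = Matrix.J (Fin 2) ℂ → DifferentiableOn ℂ (fun s => Ac₀ X i w s g) {s : ℂ | 0 < s.re}) :
    ∀ X : skewMatrices ((IsCMField.complexConj L : L ≃ₐ[Fp L] L) : L →+* L) ((gramR L e dV hdV dW hdW).map (algebraMap (Fp L) L)),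
      (X : Matrix (Fin n) (Fin n) L) ≠ 0 → (X : Matrix (Fin n) (Fin n) L).det = 0 → ∀ (h : HA L e dV hdV dW hdW), ∀ i ∈ I X h, ∀ w ∈ Tinf,
        DifferentiableOn ℂ (fun s => Ac₀ X i w s (comp X h w)) {s : ℂ | 0 < s.re} :=
  hAcw_of_localLetters
    (fun X : skewMatrices ((IsCMField.complexConj L : L ≃ₐ[Fp L] L) : L →+* L) ((gramR L e dV hdV dW hdW).map (algebraMap (Fp L) L)) =>
      (X : Matrix (Fin n) (Fin n) L) ≠ 0)
    (fun X : skewMatrices ((IsCMField.complexConj L : L ≃ₐ[Fp L] L) : L →+* L) ((gramR L e dV hdV dW hdW).map (algebraMap (Fp L) L)) =>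
      (X : Matrix (Fin n) (Fin n) L).det = 0)
    I Tinf (fun _ g => gᴴ * Matrix.J (Fin 2) ℂ * g = Matrix.J (Fin 2) ℂ) comp hcomp Ac₀ hAc₀

/-- **★ p863921's `hAw` FROM LOCAL LETTERS.**  Raw local blocks `Araw X i w : ℂ → M₄(ℂ) → ℂ` (the twisted big-cell integral at the index datum of the face at `w`) agreeing with `Ac₀ X i w`
on `{½ < re}` at every `g ∈ U(J)(ℂ)` (★ p863717 ∕ ★ p864004's second clause, guarded like the slot) ⟹ ★ p863921's `hAw` binder VERBATIM at `Aloc := fun X i w s h => Araw X i w s (comp X h w)`,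
`Acw := fun X i w s h => Ac₀ X i w s (comp X h w)`. [cite: Shimura1982, §4 Thm. 4.2] [cite: Shimura1997, §18.4] -/
theorem hAw_of_archLocalLetters {φ : Type*}
    (I : skewMatrices ((IsCMField.complexConj L : L ≃ₐ[Fp L] L) : L →+* L) ((gramR L e dV hdV dW hdW).map (algebraMap (Fp L) L)) → HA L e dV hdV dW hdW → Finset φ)
    (Tinf : Finset (InfinitePlace L))
    (comp : skewMatrices ((IsCMField.complexConj L : L ≃ₐ[Fp L] L) : L →+* L) ((gramR L e dV hdV dW hdW).map (algebraMap (Fp L) L)) → HA L e dV hdV dW hdW → InfinitePlace L →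
      Matrix (Fin 2 ⊕ Fin 2) (Fin 2 ⊕ Fin 2) ℂ)
    (hcomp : ∀ (X : skewMatrices ((IsCMField.complexConj L : L ≃ₐ[Fp L] L) : L →+* L) ((gramR L e dV hdV dW hdW).map (algebraMap (Fp L) L))) (h : HA L e dV hdV dW hdW), ∀ w ∈ Tinf,
      (comp X h w)ᴴ * Matrix.J (Fin 2) ℂ * comp X h w = Matrix.J (Fin 2) ℂ)
    (Araw Ac₀ : skewMatrices ((IsCMField.complexConj L : L ≃ₐ[Fp L] L) : L →+* L) ((gramR L e dV hdV dW hdW).map (algebraMap (Fp L) L)) → φ → InfinitePlace L → ℂ →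
      Matrix (Fin 2 ⊕ Fin 2) (Fin 2 ⊕ Fin 2) ℂ → ℂ)
    (hA₀ : ∀ X : skewMatrices ((IsCMField.complexConj L : L ≃ₐ[Fp L] L) : L →+* L) ((gramR L e dV hdV dW hdW).map (algebraMap (Fp L) L)),
      (X : Matrix (Fin n) (Fin n) L) ≠ 0 → (X : Matrix (Fin n) (Fin n) L).det = 0 → ∀ (h : HA L e dV hdV dW hdW), ∀ i ∈ I X h, ∀ w ∈ Tinf,
        ∀ s : ℂ, 1 / 2 < s.re → ∀ g : Matrix (Fin 2 ⊕ Fin 2) (Fin 2 ⊕ Fin 2) ℂ, gᴴ * Matrix.J (Fin 2) ℂ * g = Matrix.J (Fin 2) ℂ → Araw X i w s g = Ac₀ X i w s g) :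
    ∀ X : skewMatrices ((IsCMField.complexConj L : L ≃ₐ[Fp L] L) : L →+* L) ((gramR L e dV hdV dW hdW).map (algebraMap (Fp L) L)),
      (X : Matrix (Fin n) (Fin n) L) ≠ 0 → (X : Matrix (Fin n) (Fin n) L).det = 0 → ∀ (h : HA L e dV hdV dW hdW), ∀ i ∈ I X h, ∀ w ∈ Tinf,
        ∀ s : ℂ, 1 / 2 < s.re → Araw X i w s (comp X h w) = Ac₀ X i w s (comp X h w) :=
  hAw_of_localLetters
    (fun X : skewMatrices ((IsCMField.complexConj L : L ≃ₐ[Fp L] L) : L →+* L) ((gramR L e dV hdV dW hdW).map (algebraMap (Fp L) L)) =>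
      (X : Matrix (Fin n) (Fin n) L) ≠ 0)
    (fun X : skewMatrices ((IsCMField.complexConj L : L ≃ₐ[Fp L] L) : L →+* L) ((gramR L e dV hdV dW hdW).map (algebraMap (Fp L) L)) =>
      (X : Matrix (Fin n) (Fin n) L).det = 0)
    I Tinf (fun _ g => gᴴ * Matrix.J (Fin 2) ℂ * g = Matrix.J (Fin 2) ℂ) comp hcomp Araw Ac₀ hA₀

/-- **∃-FORM AT THE FRAME.**  Per `(X, h, i, w)` the local existence in ★ p863717's conclusion shape (`∃ Ac₀, (∀ g, gᴴJg = J → holomorphic) ∧ (∀ s, ½ < re s → ∀ g, gᴴJg = J → Araw = Ac₀)`)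
and the component map ⟹ `∃ Acw` with ★ p863921's `hAcw` ∧ `hAw` at `Aloc := fun X i w s h => Araw X i w s (comp X h w)`. [cite: Shimura1982, §4 Thm. 4.2] [cite: BorelJacquet1979, §4.1] -/
theorem exists_archPlaceLetters_of_localExists {φ : Type*}
    (I : skewMatrices ((IsCMField.complexConj L : L ≃ₐ[Fp L] L) : L →+* L) ((gramR L e dV hdV dW hdW).map (algebraMap (Fp L) L)) → HA L e dV hdV dW hdW → Finset φ)
    (Tinf : Finset (InfinitePlace L))
    (comp : skewMatrices ((IsCMField.complexConj L : L ≃ₐ[Fp L] L) : L →+* L) ((gramR L e dV hdV dW hdW).map (algebraMap (Fp L) L)) → HA L e dV hdV dW hdW → InfinitePlace L →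
      Matrix (Fin 2 ⊕ Fin 2) (Fin 2 ⊕ Fin 2) ℂ)
    (hcomp : ∀ (X : skewMatrices ((IsCMField.complexConj L : L ≃ₐ[Fp L] L) : L →+* L) ((gramR L e dV hdV dW hdW).map (algebraMap (Fp L) L))) (h : HA L e dV hdV dW hdW), ∀ w ∈ Tinf,
      (comp X h w)ᴴ * Matrix.J (Fin 2) ℂ * comp X h w = Matrix.J (Fin 2) ℂ)
    (Araw : skewMatrices ((IsCMField.complexConj L : L ≃ₐ[Fp L] L) : L →+* L) ((gramR L e dV hdV dW hdW).map (algebraMap (Fp L) L)) → φ → InfinitePlace L → ℂ →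
      Matrix (Fin 2 ⊕ Fin 2) (Fin 2 ⊕ Fin 2) ℂ → ℂ)
    (hloc : ∀ X : skewMatrices ((IsCMField.complexConj L : L ≃ₐ[Fp L] L) : L →+* L) ((gramR L e dV hdV dW hdW).map (algebraMap (Fp L) L)),
      (X : Matrix (Fin n) (Fin n) L) ≠ 0 → (X : Matrix (Fin n) (Fin n) L).det = 0 → ∀ (h : HA L e dV hdV dW hdW), ∀ i ∈ I X h, ∀ w ∈ Tinf,
        ∃ Ac₀ : ℂ → Matrix (Fin 2 ⊕ Fin 2) (Fin 2 ⊕ Fin 2) ℂ → ℂ,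
          (∀ g : Matrix (Fin 2 ⊕ Fin 2) (Fin 2 ⊕ Fin 2) ℂ, gᴴ * Matrix.J (Fin 2) ℂ * g = Matrix.J (Fin 2) ℂ → DifferentiableOn ℂ (fun s => Ac₀ s g) {s : ℂ | 0 < s.re}) ∧
          (∀ s : ℂ, 1 / 2 < s.re → ∀ g : Matrix (Fin 2 ⊕ Fin 2) (Fin 2 ⊕ Fin 2) ℂ, gᴴ * Matrix.J (Fin 2) ℂ * g = Matrix.J (Fin 2) ℂ → Araw X i w s g = Ac₀ s g)) :
    ∃ Acw : skewMatrices ((IsCMField.complexConj L : L ≃ₐ[Fp L] L) : L →+* L) ((gramR L e dV hdV dW hdW).map (algebraMap (Fp L) L)) → φ → InfinitePlace L → ℂ →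
        HA L e dV hdV dW hdW → ℂ,
      (∀ X : skewMatrices ((IsCMField.complexConj L : L ≃ₐ[Fp L] L) : L →+* L) ((gramR L e dV hdV dW hdW).map (algebraMap (Fp L) L)),
        (X : Matrix (Fin n) (Fin n) L) ≠ 0 → (X : Matrix (Fin n) (Fin n) L).det = 0 → ∀ (h : HA L e dV hdV dW hdW), ∀ i ∈ I X h, ∀ w ∈ Tinf,
          DifferentiableOn ℂ (fun s => Acw X i w s h) {s : ℂ | 0 < s.re}) ∧
      (∀ X : skewMatrices ((IsCMField.complexConj L : L ≃ₐ[Fp L] L) : L →+* L) ((gramR L e dV hdV dW hdW).map (algebraMap (Fp L) L)),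
        (X : Matrix (Fin n) (Fin n) L) ≠ 0 → (X : Matrix (Fin n) (Fin n) L).det = 0 → ∀ (h : HA L e dV hdV dW hdW), ∀ i ∈ I X h, ∀ w ∈ Tinf,
          ∀ s : ℂ, 1 / 2 < s.re → Araw X i w s (comp X h w) = Acw X i w s h) :=
  exists_placeLetters_of_localExists
    (fun X : skewMatrices ((IsCMField.complexConj L : L ≃ₐ[Fp L] L) : L →+* L) ((gramR L e dV hdV dW hdW).map (algebraMap (Fp L) L)) =>
      (X : Matrix (Fin n) (Fin n) L) ≠ 0)
    (fun X : skewMatrices ((IsCMField.complexConj L : L ≃ₐ[Fp L] L) : L →+* L) ((gramR L e dV hdV dW hdW).map (algebraMap (Fp L) L)) =>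
      (X : Matrix (Fin n) (Fin n) L).det = 0)
    I Tinf (fun _ g => gᴴ * Matrix.J (Fin 2) ℂ * g = Matrix.J (Fin 2) ℂ) comp hcomp Araw hloc

/-- **THE JUNCTION INTO ★ p863921: `hsplit` OF ★ p863709 WITH THE PER-PLACE LETTERS DISCHARGED FROM LOCAL LETTERS.**  ★ p863404 §2 (ii)'s `I A Ac hAc hA` VERBATIM; the component map
`comp hcomp`; local letters `Araw Ac₀ hAc₀ hA₀` on `U(J)(ℂ)`; and the place-tensor letter on `{1 < re}` for the compositions, `A X i s h = cA X h i · ∏_{w∈Tinf} Araw X i w s (comp X h w)`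
(`hAinf`, (D-arch-Fub)) ⟹ ★ p863709 `hdead_of_packageWitness_rows_hbad`'s `hsplit` at `Aw := fun X h i w => Ac₀ X i w (1/2) (comp X h w)`, `cA := cA`.
[cite: KudlaRallis1994, §2 (2.10)–(2.12)] [cite: Shimura1997, §18.4] [cite: Shimura1982, §4 Thm. 4.2] -/
theorem hsplit_faces_of_archLocalLetters {φ : Type*}
    (I : skewMatrices ((IsCMField.complexConj L : L ≃ₐ[Fp L] L) : L →+* L) ((gramR L e dV hdV dW hdW).map (algebraMap (Fp L) L)) → HA L e dV hdV dW hdW → Finset φ)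
    -- ★ p863404 §2 (ii)'s per-face arch letters `A Ac hAc hA` VERBATIM (`S ↦ X`)
    (A : skewMatrices ((IsCMField.complexConj L : L ≃ₐ[Fp L] L) : L →+* L) ((gramR L e dV hdV dW hdW).map (algebraMap (Fp L) L)) → φ → ℂ → HA L e dV hdV dW hdW → ℂ)
    (Ac : skewMatrices ((IsCMField.complexConj L : L ≃ₐ[Fp L] L) : L →+* L) ((gramR L e dV hdV dW hdW).map (algebraMap (Fp L) L)) → φ → ℂ → HA L e dV hdV dW hdW → ℂ)
    (hAc : ∀ X : skewMatrices ((IsCMField.complexConj L : L ≃ₐ[Fp L] L) : L →+* L) ((gramR L e dV hdV dW hdW).map (algebraMap (Fp L) L)),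
      (X : Matrix (Fin n) (Fin n) L) ≠ 0 → (X : Matrix (Fin n) (Fin n) L).det = 0 → ∀ (h : HA L e dV hdV dW hdW), ∀ i ∈ I X h,
        DifferentiableOn ℂ (fun s => Ac X i s h) {s : ℂ | 0 < s.re})
    (hA : ∀ X : skewMatrices ((IsCMField.complexConj L : L ≃ₐ[Fp L] L) : L →+* L) ((gramR L e dV hdV dW hdW).map (algebraMap (Fp L) L)),
      (X : Matrix (Fin n) (Fin n) L) ≠ 0 → (X : Matrix (Fin n) (Fin n) L).det = 0 → ∀ (h : HA L e dV hdV dW hdW), ∀ i ∈ I X h, ∀ s : ℂ, 1 < s.re → A X i s h = Ac X i s h)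
    -- the component map and its unitarity (of record: `Fr (archPart (gc X * h)) w`, ★ `frame_mem`)
    (Tinf : Finset (InfinitePlace L))
    (comp : skewMatrices ((IsCMField.complexConj L : L ≃ₐ[Fp L] L) : L →+* L) ((gramR L e dV hdV dW hdW).map (algebraMap (Fp L) L)) → HA L e dV hdV dW hdW → InfinitePlace L →
      Matrix (Fin 2 ⊕ Fin 2) (Fin 2 ⊕ Fin 2) ℂ)
    (hcomp : ∀ (X : skewMatrices ((IsCMField.complexConj L : L ≃ₐ[Fp L] L) : L →+* L) ((gramR L e dV hdV dW hdW).map (algebraMap (Fp L) L))) (h : HA L e dV hdV dW hdW), ∀ w ∈ Tinf,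
      (comp X h w)ᴴ * Matrix.J (Fin 2) ℂ * comp X h w = Matrix.J (Fin 2) ℂ)
    -- the local letters per `(X, i, w)` on `U(J)(ℂ)` (★ p863717 ∕ ★ p864004's shape, guarded like the slot)
    (Araw Ac₀ : skewMatrices ((IsCMField.complexConj L : L ≃ₐ[Fp L] L) : L →+* L) ((gramR L e dV hdV dW hdW).map (algebraMap (Fp L) L)) → φ → InfinitePlace L → ℂ →
      Matrix (Fin 2 ⊕ Fin 2) (Fin 2 ⊕ Fin 2) ℂ → ℂ)
    (hAc₀ : ∀ X : skewMatrices ((IsCMField.complexConj L : L ≃ₐ[Fp L] L) : L →+* L) ((gramR L e dV hdV dW hdW).map (algebraMap (Fp L) L)),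
      (X : Matrix (Fin n) (Fin n) L) ≠ 0 → (X : Matrix (Fin n) (Fin n) L).det = 0 → ∀ (h : HA L e dV hdV dW hdW), ∀ i ∈ I X h, ∀ w ∈ Tinf,
        ∀ g : Matrix (Fin 2 ⊕ Fin 2) (Fin 2 ⊕ Fin 2) ℂ, gᴴ * Matrix.J (Fin 2) ℂ * g = Matrix.J (Fin 2) ℂ → DifferentiableOn ℂ (fun s => Ac₀ X i w s g) {s : ℂ | 0 < s.re})
    (hA₀ : ∀ X : skewMatrices ((IsCMField.complexConj L : L ≃ₐ[Fp L] L) : L →+* L) ((gramR L e dV hdV dW hdW).map (algebraMap (Fp L) L)),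
      (X : Matrix (Fin n) (Fin n) L) ≠ 0 → (X : Matrix (Fin n) (Fin n) L).det = 0 → ∀ (h : HA L e dV hdV dW hdW), ∀ i ∈ I X h, ∀ w ∈ Tinf,
        ∀ s : ℂ, 1 / 2 < s.re → ∀ g : Matrix (Fin 2 ⊕ Fin 2) (Fin 2 ⊕ Fin 2) ℂ, gᴴ * Matrix.J (Fin 2) ℂ * g = Matrix.J (Fin 2) ℂ → Araw X i w s g = Ac₀ X i w s g)
    -- the place-tensor letter for the compositions, with its scalar `cA` ((D-arch-Fub))
    (cA : skewMatrices ((IsCMField.complexConj L : L ≃ₐ[Fp L] L) : L →+* L) ((gramR L e dV hdV dW hdW).map (algebraMap (Fp L) L)) → HA L e dV hdV dW hdW → φ → ℂ)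
    (hAinf : ∀ X : skewMatrices ((IsCMField.complexConj L : L ≃ₐ[Fp L] L) : L →+* L) ((gramR L e dV hdV dW hdW).map (algebraMap (Fp L) L)),
      (X : Matrix (Fin n) (Fin n) L) ≠ 0 → (X : Matrix (Fin n) (Fin n) L).det = 0 → ∀ (h : HA L e dV hdV dW hdW), ∀ i ∈ I X h,
        ∀ s : ℂ, 1 < s.re → A X i s h = cA X h i * ∏ w ∈ Tinf, Araw X i w s (comp X h w)) :
    ∀ (X : skewMatrices ((IsCMField.complexConj L : L ≃ₐ[Fp L] L) : L →+* L) ((gramR L e dV hdV dW hdW).map (algebraMap (Fp L) L))) (h : HA L e dV hdV dW hdW),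
      (X : Matrix (Fin n) (Fin n) L) ≠ 0 → (X : Matrix (Fin n) (Fin n) L).det = 0 → ∀ i ∈ I X h,
        Ac X i (1 / 2) h = cA X h i * ∏ w ∈ Tinf, Ac₀ X i w (1 / 2) (comp X h w) :=
  hsplit_faces_of_archLetters L e dV hdV dW hdW I A Ac hAc hA Tinf (fun X i w s h => Araw X i w s (comp X h w)) (fun X i w s h => Ac₀ X i w s (comp X h w))
    (hAcw_of_archLocalLetters L e dV hdV dW hdW I Tinf comp hcomp Ac₀ hAc₀) (hAw_of_archLocalLetters L e dV hdV dW hdW I Tinf comp hcomp Araw Ac₀ hA₀) cA hAinf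

end Frame

/-! ## §3 The component map of record: the tube frame at the archimedean part (rank `2`) -/

section OfFrame

variable (L : Type) [Field L] [NumberField L] [IsCMField L]

variable {N M : ℕ} (e : Fin N × Fin M ≃ Fin 2)
  (dV : Fin N → L) (hdV : ∀ i, IsCMField.complexConj L (dV i) = dV i)
  (dW : Fin M → L) (hdW : ∀ i, IsCMField.complexConj L (dW i) = dW i)

/-- **THE COMPONENT MAP OF RECORD LANDS IN `U(J)(ℂ)`.**  For a tube frame `Fr : H_∞ → {w ∣ complex} → M₄(ℂ)` with `(Fr a w)ᴴ · J · Fr a w = J` (★ `K2LiuHolTubeRigidityOfFrame.frame_mem`'s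
conclusion BY VALUE, `hFrU`), the component map `comp X h w := Fr (archPart (gc X · h)) ⟨w, _⟩` at the corner translate `gc X` (by value; `fun _ => 1` untranslated; every infinite place of the CM field `L` is complex) satisfies `hcomp` at every `w`.
[cite: Shimura1997, §5] [cite: BorelJacquet1979, §4.1] -/
theorem hcomp_of_frame
    (Fr : UnitaryGroup.arch (Fp L) L (IsCMField.complexConj L) (2 + 2) (hermD L e dV hdV dW hdW) → {w : InfinitePlace L // w.IsComplex} →
      Matrix (Fin 2 ⊕ Fin 2) (Fin 2 ⊕ Fin 2) ℂ)
    (hFrU : ∀ (a : UnitaryGroup.arch (Fp L) L (IsCMField.complexConj L) (2 + 2) (hermD L e dV hdV dW hdW)) (w : {w : InfinitePlace L // w.IsComplex}),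
      (Fr a w)ᴴ * Matrix.J (Fin 2) ℂ * Fr a w = Matrix.J (Fin 2) ℂ)
    (gc : skewMatrices ((IsCMField.complexConj L : L ≃ₐ[Fp L] L) : L →+* L) ((gramR L e dV hdV dW hdW).map (algebraMap (Fp L) L)) → HA L e dV hdV dW hdW)
    (Tinf : Finset (InfinitePlace L)) :
    ∀ (X : skewMatrices ((IsCMField.complexConj L : L ≃ₐ[Fp L] L) : L →+* L) ((gramR L e dV hdV dW hdW).map (algebraMap (Fp L) L))) (h : HA L e dV hdV dW hdW), ∀ w ∈ Tinf,
      (Fr (UnitaryGroup.archPart (Fp L) L (IsCMField.complexConj L) (2 + 2) (hermD L e dV hdV dW hdW) (gc X * h)) ⟨w, IsTotallyComplex.isComplex w⟩)ᴴ * Matrix.J (Fin 2) ℂ *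
        Fr (UnitaryGroup.archPart (Fp L) L (IsCMField.complexConj L) (2 + 2) (hermD L e dV hdV dW hdW) (gc X * h)) ⟨w, IsTotallyComplex.isComplex w⟩ = Matrix.J (Fin 2) ℂ :=
  fun X h w _ => hFrU (UnitaryGroup.archPart (Fp L) L (IsCMField.complexConj L) (2 + 2) (hermD L e dV hdV dW hdW) (gc X * h)) ⟨w, IsTotallyComplex.isComplex w⟩

/-- **★ p863921's `hAcw` OVER THE FRAME OF RECORD**: local continuations holomorphic on `U(J)(ℂ)` composed with `h ↦ Fr (archPart (gc X · h)) ⟨w, _⟩`.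
[cite: Shimura1982, §4 Thm. 4.2] [cite: Shimura1997, §5] -/
theorem hAcw_of_frame {φ : Type*}
    (I : skewMatrices ((IsCMField.complexConj L : L ≃ₐ[Fp L] L) : L →+* L) ((gramR L e dV hdV dW hdW).map (algebraMap (Fp L) L)) → HA L e dV hdV dW hdW → Finset φ)
    (Tinf : Finset (InfinitePlace L))
    (Fr : UnitaryGroup.arch (Fp L) L (IsCMField.complexConj L) (2 + 2) (hermD L e dV hdV dW hdW) → {w : InfinitePlace L // w.IsComplex} →
      Matrix (Fin 2 ⊕ Fin 2) (Fin 2 ⊕ Fin 2) ℂ)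
    (hFrU : ∀ (a : UnitaryGroup.arch (Fp L) L (IsCMField.complexConj L) (2 + 2) (hermD L e dV hdV dW hdW)) (w : {w : InfinitePlace L // w.IsComplex}),
      (Fr a w)ᴴ * Matrix.J (Fin 2) ℂ * Fr a w = Matrix.J (Fin 2) ℂ)
    (gc : skewMatrices ((IsCMField.complexConj L : L ≃ₐ[Fp L] L) : L →+* L) ((gramR L e dV hdV dW hdW).map (algebraMap (Fp L) L)) → HA L e dV hdV dW hdW)
    (Ac₀ : skewMatrices ((IsCMField.complexConj L : L ≃ₐ[Fp L] L) : L →+* L) ((gramR L e dV hdV dW hdW).map (algebraMap (Fp L) L)) → φ → InfinitePlace L → ℂ →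
      Matrix (Fin 2 ⊕ Fin 2) (Fin 2 ⊕ Fin 2) ℂ → ℂ)
    (hAc₀ : ∀ X : skewMatrices ((IsCMField.complexConj L : L ≃ₐ[Fp L] L) : L →+* L) ((gramR L e dV hdV dW hdW).map (algebraMap (Fp L) L)),
      (X : Matrix (Fin 2) (Fin 2) L) ≠ 0 → (X : Matrix (Fin 2) (Fin 2) L).det = 0 → ∀ (h : HA L e dV hdV dW hdW), ∀ i ∈ I X h, ∀ w ∈ Tinf,
        ∀ g : Matrix (Fin 2 ⊕ Fin 2) (Fin 2 ⊕ Fin 2) ℂ, gᴴ * Matrix.J (Fin 2) ℂ * g = Matrix.J (Fin 2) ℂ → DifferentiableOn ℂ (fun s => Ac₀ X i w s g) {s : ℂ | 0 < s.re}) :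
    ∀ X : skewMatrices ((IsCMField.complexConj L : L ≃ₐ[Fp L] L) : L →+* L) ((gramR L e dV hdV dW hdW).map (algebraMap (Fp L) L)),
      (X : Matrix (Fin 2) (Fin 2) L) ≠ 0 → (X : Matrix (Fin 2) (Fin 2) L).det = 0 → ∀ (h : HA L e dV hdV dW hdW), ∀ i ∈ I X h, ∀ w ∈ Tinf,
        DifferentiableOn ℂ (fun s => Ac₀ X i w s
          (Fr (UnitaryGroup.archPart (Fp L) L (IsCMField.complexConj L) (2 + 2) (hermD L e dV hdV dW hdW) (gc X * h)) ⟨w, IsTotallyComplex.isComplex w⟩)) {s : ℂ | 0 < s.re} :=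
  hAcw_of_archLocalLetters L e dV hdV dW hdW I Tinf
    (fun X h w => Fr (UnitaryGroup.archPart (Fp L) L (IsCMField.complexConj L) (2 + 2) (hermD L e dV hdV dW hdW) (gc X * h)) ⟨w, IsTotallyComplex.isComplex w⟩)
    (hcomp_of_frame L e dV hdV dW hdW Fr hFrU gc Tinf) Ac₀ hAc₀

/-- **★ p863921's `hAw` OVER THE FRAME OF RECORD**: raw local blocks agreeing with their continuations on `{½ < re}` at `U(J)(ℂ)`, composed with `h ↦ Fr (archPart (gc X · h)) ⟨w, _⟩`.
[cite: Shimura1982, §4 Thm. 4.2] [cite: Shimura1997, §18.4] -/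
theorem hAw_of_frame {φ : Type*}
    (I : skewMatrices ((IsCMField.complexConj L : L ≃ₐ[Fp L] L) : L →+* L) ((gramR L e dV hdV dW hdW).map (algebraMap (Fp L) L)) → HA L e dV hdV dW hdW → Finset φ)
    (Tinf : Finset (InfinitePlace L))
    (Fr : UnitaryGroup.arch (Fp L) L (IsCMField.complexConj L) (2 + 2) (hermD L e dV hdV dW hdW) → {w : InfinitePlace L // w.IsComplex} →
      Matrix (Fin 2 ⊕ Fin 2) (Fin 2 ⊕ Fin 2) ℂ)
    (hFrU : ∀ (a : UnitaryGroup.arch (Fp L) L (IsCMField.complexConj L) (2 + 2) (hermD L e dV hdV dW hdW)) (w : {w : InfinitePlace L // w.IsComplex}),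
      (Fr a w)ᴴ * Matrix.J (Fin 2) ℂ * Fr a w = Matrix.J (Fin 2) ℂ)
    (gc : skewMatrices ((IsCMField.complexConj L : L ≃ₐ[Fp L] L) : L →+* L) ((gramR L e dV hdV dW hdW).map (algebraMap (Fp L) L)) → HA L e dV hdV dW hdW)
    (Araw Ac₀ : skewMatrices ((IsCMField.complexConj L : L ≃ₐ[Fp L] L) : L →+* L) ((gramR L e dV hdV dW hdW).map (algebraMap (Fp L) L)) → φ → InfinitePlace L → ℂ →
      Matrix (Fin 2 ⊕ Fin 2) (Fin 2 ⊕ Fin 2) ℂ → ℂ)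
    (hA₀ : ∀ X : skewMatrices ((IsCMField.complexConj L : L ≃ₐ[Fp L] L) : L →+* L) ((gramR L e dV hdV dW hdW).map (algebraMap (Fp L) L)),
      (X : Matrix (Fin 2) (Fin 2) L) ≠ 0 → (X : Matrix (Fin 2) (Fin 2) L).det = 0 → ∀ (h : HA L e dV hdV dW hdW), ∀ i ∈ I X h, ∀ w ∈ Tinf,
        ∀ s : ℂ, 1 / 2 < s.re → ∀ g : Matrix (Fin 2 ⊕ Fin 2) (Fin 2 ⊕ Fin 2) ℂ, gᴴ * Matrix.J (Fin 2) ℂ * g = Matrix.J (Fin 2) ℂ → Araw X i w s g = Ac₀ X i w s g) :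
    ∀ X : skewMatrices ((IsCMField.complexConj L : L ≃ₐ[Fp L] L) : L →+* L) ((gramR L e dV hdV dW hdW).map (algebraMap (Fp L) L)),
      (X : Matrix (Fin 2) (Fin 2) L) ≠ 0 → (X : Matrix (Fin 2) (Fin 2) L).det = 0 → ∀ (h : HA L e dV hdV dW hdW), ∀ i ∈ I X h, ∀ w ∈ Tinf,
        ∀ s : ℂ, 1 / 2 < s.re →
          Araw X i w s (Fr (UnitaryGroup.archPart (Fp L) L (IsCMField.complexConj L) (2 + 2) (hermD L e dV hdV dW hdW) (gc X * h)) ⟨w, IsTotallyComplex.isComplex w⟩) =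
            Ac₀ X i w s (Fr (UnitaryGroup.archPart (Fp L) L (IsCMField.complexConj L) (2 + 2) (hermD L e dV hdV dW hdW) (gc X * h)) ⟨w, IsTotallyComplex.isComplex w⟩) :=
  hAw_of_archLocalLetters L e dV hdV dW hdW I Tinf
    (fun X h w => Fr (UnitaryGroup.archPart (Fp L) L (IsCMField.complexConj L) (2 + 2) (hermD L e dV hdV dW hdW) (gc X * h)) ⟨w, IsTotallyComplex.isComplex w⟩)
    (hcomp_of_frame L e dV hdV dW hdW Fr hFrU gc Tinf) Araw Ac₀ hA₀

end OfFrame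

end Summit.HodgeConjecture.HodgeConjecture.Cruxes.HLiu418.K2LiuIncoherentRankOneArchPlaceLettersOfScalarType

end
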